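import Literature.NumberTheory.EllipticCurves.HeightConductorBoundsPropTenEightProofs
import Literature.NumberTheory.DiophantineGeometry.SUnitHeightBoundFirstDisplayProofs
import Literature.NumberTheory.DiophantineGeometry.MordellHeightBoundModularityProofs
import Literature.NumberTheory.DiophantineGeometry.AbcHeightBoundFreyHellegouarchProofs
import HarnessLib

/-!
# von Känel–Matschke, `Ω_opt ≤ Ω_sim` — PROVED; the §10 Diophantine chain with Prop. 10.8 (ii) discharged

Topic `Literature/NumberTheory/DiophantineGeometry` (family `abc`, LADDER-ABC A1: the *modular method*).
A proofs-only companion (theorems only; NO definition, NO new named fact, nothing restated; D-0026)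
of `OptimizedHeightBoundsModularity.lean` and `SUnitMordellHeightBoundsModularity.lean`, for
R. von Känel, B. Matschke, arXiv:1605.06079 = Mem. AMS **286** (2023) no. 1419 [`VonkanelMatschke2023`].

Now that vKM Prop. 10.8 (ii) is a THEOREM of the tree (`vonKanelMatschke_prop_10_8_ii_holds`,
`HeightConductorBoundsPropTenEightProofs.lean`), the printed deductions of §8.2, §9, §10.1–§10.5 that
were proved conditionally on (ii) become one root shorter:

* **`omegaOpt_le_omegaSim_holds`** — the named fact `omegaOpt_le_omegaSim` (§8.2 and §9: *"It holds
  `Ω_opt ≤ Ω_sim`"*) is DISCHARGED (`omegaOpt_le_omegaSim_of_prop_10_8_ii` with (ii) a theorem);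
* Prop. 10.1 (`mordell_height_le`) from Prop. 10.7 alone (`mordell_height_le_of_proposition_10_7'`),
  and from modularity + Lemma 10.3 + Prop. 10.8 (i) (`mordell_height_le_of_lemma_10_3_of_prop_10_8_i`);
* the simplified corollaries 9.1/9.3 from the exact ones alone (`corollary_9_1_sim_of'`,
  `corollary_9_3_sim_of'`);
* Prop. 10.6 (`abc_log_max_le_refined`) from modularity, the Ogg–Saito schema, Lemma 10.5 and
  Prop. 10.8 (i) (`abc_log_max_le_refined_of_modularity_of_prop_10_8_i`), and with it Prop. 10.2
  (second display for all `S`, both displays for `N_S ≥ 53`: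
  `sUnitEquation_height_le_two_of_modularity_of_prop_10_8_i`,
  `sUnitEquation_height_le_of_le_of_modularity_of_prop_10_8_i`).

Remaining roots of the vKM §10 DAG in the kernel: `nonempty_modularParametrizationData` (modularity),
`vonKanelMatschke_prop_10_8_i`, `vonKanelMatschke_lemma_10_3`, `vonKanelMatschke_lemma_10_5`, the
Ogg–Saito schema (isogeny invariance of the conductor), and `proposition_10_7` / `corollary_9_1` /
`corollary_9_3` for the optimized statements. No `abc` claim; typed ≠ endorsed. All theorems; axioms standard.

## References

* [VonkanelMatschke2023] R. von Känel, B. Matschke, arXiv:1605.06079 = Mem. AMS 286 (2023), §8.2/§9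
  (`Ω_opt ≤ Ω_sim`), §10.1 (Props. 10.1, 10.2), §10.3–§10.5 (proofs; Props. 10.6, 10.7, 10.8).
-/

noncomputable section

open Height
open Literature.NumberTheory.EllipticCurves.ModularForms

namespace Literature.NumberTheory.DiophantineGeometry

namespace VonKanelMatschke

/-! ### `Ω_opt ≤ Ω_sim`, discharged -/

/-- **vKM `Ω_opt ≤ Ω_sim` — PROVED** (§8.2: *"It holds `Ω_opt ≤ Ω_sim = (1/3)h(k) + (4/9)k_S log k_S
+ (1/6)k_S log log log k_S + (2/5)k_S`"*, §9 likewise): the printed deduction from Prop. 10.8 (ii)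
(`omegaOpt_le_omegaSim_of_prop_10_8_ii`) applied to the theorem `vonKanelMatschke_prop_10_8_ii_holds`.
Discharges the named fact `omegaOpt_le_omegaSim`. [cite: VonkanelMatschke2023, §8.2 and §9 (display Ω_opt ≤ Ω_sim)] -/
theorem omegaOpt_le_omegaSim_holds : omegaOpt_le_omegaSim :=
  omegaOpt_le_omegaSim_of_prop_10_8_ii vonKanelMatschke_prop_10_8_ii_holds

/-- **Prop. 10.1 from Prop. 10.7 alone** (the printed "simplified versions of our bounds", §10.1;
`mordell_height_le_of_proposition_10_7` with `Ω_opt ≤ Ω_sim` now a theorem).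
[cite: VonkanelMatschke2023, §10.1 and §10.5.1 (Prop. 10.7 ⟹ Prop. 10.1)] -/
theorem mordell_height_le_of_proposition_10_7' (h : proposition_10_7) : mordell_height_le :=
  mordell_height_le_of_proposition_10_7 h omegaOpt_le_omegaSim_holds

/-- **Cor. 9.1 (exact) ⟹ its simplified form**, unconditionally. [cite: VonkanelMatschke2023, §9 (after Cor. 9.1)] -/
theorem corollary_9_1_sim_of' (h : corollary_9_1) : corollary_9_1_sim :=
  corollary_9_1_sim_of h omegaOpt_le_omegaSim_holds

/-- **Cor. 9.3 (exact) ⟹ its simplified form**, unconditionally. [cite: VonkanelMatschke2023, §9 (Ω with Ω_opt ≤ Ω_sim)] -/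
theorem corollary_9_3_sim_of' (h : corollary_9_3) : corollary_9_3_sim :=
  corollary_9_3_sim_of h omegaOpt_le_omegaSim_holds

/-! ### Prop. 10.1 and Prop. 10.6 / 10.2 from the remaining roots -/

/-- **Prop. 10.1 (`mordell_height_le`) from modularity, Lemma 10.3 and Prop. 10.8 (i)** — the printed
proof of §10.3 (`mordell_height_le_of_lemma_10_3`) with Prop. 10.8 (ii) discharged.
[cite: VonkanelMatschke2023, Prop. 10.1 (arXiv §10.1.1, prop:m) with §10.3 (proof of Prop. 10.1)] -/
theorem mordell_height_le_of_lemma_10_3_of_prop_10_8_i (hmod : nonempty_modularParametrizationData)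
    (h103 : vonKanelMatschke_lemma_10_3) (hi : vonKanelMatschke_prop_10_8_i) : mordell_height_le :=
  mordell_height_le_of_lemma_10_3 hmod h103 hi vonKanelMatschke_prop_10_8_ii_holds

/-- **Prop. 10.6 (`abc_log_max_le_refined`) from modularity, the Ogg–Saito schema, Lemma 10.5 and
Prop. 10.8 (i)** — the printed chain `Lemma 10.5 + Prop. 10.8 ⟹ (eq:szpiro) ⟹ Prop. 10.6` of
§10.4–§10.5 with (ii) discharged. [cite: VonkanelMatschke2023, §10.4–§10.5 (Prop. 10.6 via (eq:szpiro) and Prop. 10.8)] -/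
theorem abc_log_max_le_refined_of_modularity_of_prop_10_8_i (hmod : nonempty_modularParametrizationData)
    (hOS : ∀ (W : WeierstrassCurve ℚ) (ℓ : ℕ) [Fact ℓ.Prime],
      W.artinConductorExponent_tate_eq_conductorExponent_of_isElliptic ℓ)
    (h105 : vonKanelMatschke_lemma_10_5) (hi : vonKanelMatschke_prop_10_8_i) :
    abc_log_max_le_refined :=
  abc_log_max_le_refined_of_lemma_10_5 hmod hOS h105
    (log_minimalDiscriminant_le_of_prop_10_8_i hmod hi)

/-- **Prop. 10.2, the (second, refined) display `(12/5) N_S log N_S + (9/10) N_S log log log(16 N_S)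
+ 8.26 N_S + 28`, for every finite set of primes `S`**, from modularity, Ogg–Saito, Lemma 10.5 and
Prop. 10.8 (i) (§10.4: "Prop. 10.6 implies Prop. 10.2"; `sUnitEquation_height_le_two_of_abc_log_max_le_refined`).
[cite: VonkanelMatschke2023, Prop. 10.2 (arXiv §10.1.2, prop:su) with §10.4] -/
theorem sUnitEquation_height_le_two_of_modularity_of_prop_10_8_i
    (hmod : nonempty_modularParametrizationData)
    (hOS : ∀ (W : WeierstrassCurve ℚ) (ℓ : ℕ) [Fact ℓ.Prime],
      W.artinConductorExponent_tate_eq_conductorExponent_of_isElliptic ℓ)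
    (h105 : vonKanelMatschke_lemma_10_5) (hi : vonKanelMatschke_prop_10_8_i)
    (S : Finset ℕ) (hS : ∀ p ∈ S, p.Prime) (x y : ℚ) (hx : IsSUnit S x) (hy : IsSUnit S y)
    (hxy : x + y = 1) :
    max (logHeight₁ x) (logHeight₁ y) ≤
      12 / 5 * (primesProd S : ℝ) * Real.log (primesProd S) +
        9 / 10 * (primesProd S : ℝ) * Real.log (Real.log (Real.log (16 * (primesProd S : ℝ)))) +
        8.26 * (primesProd S : ℝ) + 28 :=
  sUnitEquation_height_le_two_of_abc_log_max_le_refined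
    (abc_log_max_le_refined_of_modularity_of_prop_10_8_i hmod hOS h105 hi) S hS x y hx hy hxy

/-- **Prop. 10.2, both displays (`(5/2) N_S log N_S + 9 N_S` and the refined one), for `N_S ≥ 53`** (every
`S` outside the eleven small sets of the finding recorded in `SUnitMordellHeightBoundsModularityProofs`),
from modularity, Ogg–Saito, Lemma 10.5 and Prop. 10.8 (i).
[cite: VonkanelMatschke2023, Prop. 10.2 (arXiv §10.1.2, prop:su) with §10.4] -/
theorem sUnitEquation_height_le_of_le_of_modularity_of_prop_10_8_i
    (hmod : nonempty_modularParametrizationData)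
    (hOS : ∀ (W : WeierstrassCurve ℚ) (ℓ : ℕ) [Fact ℓ.Prime],
      W.artinConductorExponent_tate_eq_conductorExponent_of_isElliptic ℓ)
    (h105 : vonKanelMatschke_lemma_10_5) (hi : vonKanelMatschke_prop_10_8_i)
    (S : Finset ℕ) (hS : ∀ p ∈ S, p.Prime) (hN : 53 ≤ primesProd S) (x y : ℚ) (hx : IsSUnit S x)
    (hy : IsSUnit S y) (hxy : x + y = 1) :
    max (logHeight₁ x) (logHeight₁ y) ≤
        5 / 2 * (primesProd S : ℝ) * Real.log (primesProd S) + 9 * (primesProd S : ℝ) ∧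
    max (logHeight₁ x) (logHeight₁ y) ≤
        12 / 5 * (primesProd S : ℝ) * Real.log (primesProd S) +
          9 / 10 * (primesProd S : ℝ) * Real.log (Real.log (Real.log (16 * (primesProd S : ℝ)))) +
          8.26 * (primesProd S : ℝ) + 28 :=
  abc_log_max_le_refined_imp_sUnitEquation_height_le_of_le
    (abc_log_max_le_refined_of_modularity_of_prop_10_8_i hmod hOS h105 hi) S hS hN x y hx hy hxy

/-- **Prop. 10.1 from the remaining roots, both printed ways**: modularity + Lemma 10.3 + Prop. 10.8 (i)
give `mordell_height_le`, as does Prop. 10.7 alone. [cite: VonkanelMatschke2023, §10.1.1 and §10.3 (Prop. 10.1), §10.5.1 (Prop. 10.7)] -/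
theorem mordell_height_le_of_roots' (hmod : nonempty_modularParametrizationData)
    (h103 : vonKanelMatschke_lemma_10_3) (hi : vonKanelMatschke_prop_10_8_i) :
    mordell_height_le ∧ (proposition_10_7 → mordell_height_le) :=
  ⟨mordell_height_le_of_lemma_10_3_of_prop_10_8_i hmod h103 hi, mordell_height_le_of_proposition_10_7'⟩

end VonKanelMatschke

end Literature.NumberTheory.DiophantineGeometry

end
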